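import Mathlib
import HarnessLib
import HarnessLib.Audit
import Summits.QuantumFields.Statement
import Summits.QuantumFields.YangMills.Theses.UnitScaleTilt
import Literature.MathematicalPhysics.QuantumFieldTheory.Balaban1983to89.T3YM3TorusStatement
import HarnessLib.Audit.Status.Attr

/-!
Route: LocalInsertion

# Route LocalInsertion — A fixed-epsilon exponential moment of the capped block flux — one localised
insertion in the free energy — already gives the history tails

LINE 16 of ideator seat ym-r3-idea-2 (g7, lens «nearmiss»; bears_on LADDER-YM rung R3 = leaf
`T3YM3TorusStatement.YM3TorusSU2` via crux stmt-QuantumFields-19936 `UnitScaleTilt.HistoryTailL`; no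
summit and no rung is proved by this line). It suffices to show X = LocalInsertionL: for every L
there is ONE fixed ε = ε(L) > 0 such that for all Bałaban thresholds (b₀, p₀) the cut-off-K Gibbs
law has a K-, j- and plaquette-uniform bound M₀ on the exponential moment ∫_G exp(ε ·
min(dist1(Ū^j(∂a))/g, p(g))) d gibbsK, g = g_(K−j) = √(γL^(−(K−j))), p = B10.pFun b₀ p₀, taken over
the LOCAL small-history event G(a,j) (all finer averaged plaquettes within torus distance 64·L^j of
a below their thresholds). This is the free-energy shift log Z_K(ε·φ_a)/Z_K(0) ≤ log M₀ under ONE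
localised, bounded (≤ ε·p), gauge-invariant insertion φ_a at height j. Glue (support item
HistoryTailOfInsertionL, provable): Chernoff at the fixed ε gives the local LINEAR-exponential tail
M₀·e^(−ε·p(g)); because p(g_i) ≥ b₀(1 + i·log L/2) and the route may CHOOSE b₀ ≥ 8/ε (HistoryTailL
quantifies ∃ b₀ ≥ b₁), the union bound over the ≤ 72·L^(3m)·L^(3i) plaquettes of each height and the
finest-bad-level recursion over the local events converge — a geometric profile exactly as in the
tree's `averagedTailAt_of_perPlaquette`, with e^(−c p²) replaced by e^(−ε p) and a large b₀.
Lean: `LocalInsertionL`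

## Assembly
Pure logic on top of the parent's deciding theorem: `closes h200 h201 hI hG := UnitScaleTilt.closes
h200 h201 (hG hI)` concludes the leaf `YM3TorusSU2` (rung R3; not the summit Statement). Every
binder is consumed; the Assembly item restates the composition (proved by `closes`).

CLOSES_TARGET: closes rung R3 of QuantumFields: Literature.MathematicalPhysics.QuantumFieldTheory.Balaban1983to89.T3YM3TorusStatement.YM3TorusSU2 (D-0061; not the summit Statement) — the deciding theorem of this route concludes that registered leaf instead of the Statement decl `YangMills` (class rung: servable and labelled, never counted as concluding the summit Statement).

Rationale: WHY THIS LINE. Near-miss harvested: every tail route on this crux (FibreConvexityTail 25567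
`exp(−c·pFun²)`, MultiscaleHerbst 28309 sub-Gaussian MGF cap up to λ ≍ pFun, FirstExitWindow 26243,
CovariantDischarge 22891/22892, RevelationMartingale 23082, and LINE 15's Gaussian concentration)
demands GAUSSIAN-class control of the block flux, inherited from Bałaban's printed factors
exp(−¼p(g)²) [Balaban1985UV3 (71)]; the measured deficit of each is the sub-Gaussian window. The
single input to improve turns out to be unnecessary: `HistoryTailAt` asks only for a summable
profile, and since p(g_i) grows linearly in i = K − j with slope ∝ b₀ — a constant the target lets
us choose — a LINEAR-exponential per-plaquette tail with any fixed rate ε already beats the L^(3i)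
plaquette counts once b₀ ≥ 8/ε. The organ therefore drops one class: from sub-Gaussian MGFs (all λ ≤
pFun) to ONE exponential moment at a fixed small ε, i.e. to the free-energy shift under a single
localised bounded insertion — the currency of the renormalisation-group observable calculus
[Balaban–O'Carroll, doi:10.1006/aphy.1997.5690; Dimock arXiv:1304.0705 p.33 Remark] and of
reflection-positivity/chessboard transfer to a periodised pressure. Imported: Chernoff at fixed
parameter, generating-functional (insertion) formalism of constructive RG; nothing from
concentration theory is needed.

RANKED CRUXES. #2 LocalInsertionL (crux) — For every L there is ε > 0 such that for all b₀ > 0, p₀ >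
2 there are M₀ ≥ 0 and γ₁ ∈ (0,1] with: for every family F with F.L = L, every γ ∈ (0, γ₁], every K,
every height 1 ≤ j ≤ K and every plaquette a of height j, the gibbsK-integral over the local
small-history event G(a,j) of exp(ε·min(dist1(Ū^j(∂a))/g_(K−j), pFun b₀ p₀ g_(K−j))) is at most M₀.
[difficulty: XL] (why it might fail: the insertion has modulus up to e^(ε·p) at the edge of the
small-field domain; Bałaban–O'Carroll's observable calculus is perturbative in ε (derivatives at 0),
so a finite-ε bound uniform in K may need Gaussian-class control after all, or ε forced ∝ g^κ
(useless).) [Balaban1985UV3, doi:10.1006/aphy.1997.5690, arXiv:1304.0705, arXiv:2009.01156]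
#3 FluctuationComparisonRegPrIntL (crux) — Residual crux of the parent route UnitScaleTilt
(stmt-QuantumFields-20520), restated byte-identically (shared item; not attacked by this line).
[difficulty: XL] (why it might fail: interior excision of the fluctuation integral at printed
regularity may lose the ε₀-uniformity in m (parent route's recorded risk).) [Balaban1985UV3,
Balaban1988Convergent]
#4 MinimiserStabilityRegPr (crux) — Residual crux of the parent route UnitScaleTilt
(stmt-QuantumFields-19200), restated byte-identically (shared item; not attacked by this line).
[difficulty: XL] (why it might fail: stability of the printed regular minimiser needs the B13
contraction constants uniformly in the torus size (parent route's recorded risk).) [Balaban1985UV3,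
Balaban1987RG1]
#9 HistoryTailOfInsertionL (support) — The glue: LocalInsertionL implies UnitScaleTilt.HistoryTailL
— Chernoff at the fixed ε (on the event the capped variable equals its cap), the finest-bad-level
recursion T_j ≤ M₀e^(−εp(g_(K−j))) + C·Σ_(i<j) L^(3(j−i))·T_i over the local events (closing because
p(g_(K−i)) − p(g_(K−j)) ≥ b₀(j−i)·log L/2 and b₀ ≥ 8/ε), the bare level from
`T3BareTailProfile.bareTailAt`, then the union bound and packaging of
`averagedTailAt_of_perPlaquette`/`historyTailAt_of_averagedTailAt` with the linear exponent; choose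
b₀ := max(b₁, 8/ε, 1), p₀ := max(p₁, 3). [deps: LocalInsertionL] [difficulty: L] [Balaban1985UV3]

TWO-LAYER PLAN. Foreseen split of LocalInsertionL by height once the instrument row is in:
InsertionHeightOne (j = 1: one averaging of bare links; first rung, L-sized: conditional
Bakry–Émery/Herbst on SU(2)^box in Bałaban's level-0 chart with the landed bare tails, box of side
O(L)) → InsertionHigher (j ≥ 2; organ-adjacent, 0 seats until row R16 is in) → LocalInsertionL (glue
= case split on j, trivial seam). Three engines recorded for InsertionHigher: (E1) RG observable
calculus at finite ε; (E2) reflection positivity of gibbsK inherited by block averages over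
reflection-compatible blocks + chessboard ⇒ the periodised pressure shift, then UV stability of a
homogeneously perturbed action; (E3) LINE 15's MesoscopicConcentrationL ∧ BlockLipschitzL implies it
(shared progress).

KILL CRITERIA. Refutation of LocalInsertionL closes the route outright (close --reason
refuted:LocalInsertionL): a family of heights/plaquettes along which the fixed-ε exponential moment
over the local event grows with K, e.g. a block flux whose law on G(a,j) has a
heavier-than-exponential shoulder below the cap. Instrument row R16 (engines; L ∈ {2,3}, K ∈
{4,6,8}, ε ∈ {1/4, 1/2, 1}, every height j): the empirical log-moment log
E_K[exp(ε·min(dist1(Ū^j(∂a))/g_(K−j), p))·1_G(a,j)] at fixed (ε, L, K−j) must be constant in K and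
bounded in K−j — KILL if it grows with K, or tracks ε·p(g_(K−j)) (cap saturated). Literature row: if
[doi:10.1006/aphy.1997.5690] / [arXiv:2009.01156 Thm 1] force observable activities ≤ g^κ (no
finite-ε insertion), engine E1 is struck and the line rests on E2/E3. Refutation of a parent
residual closes the parent programme, not this line specifically.

NOT DECOMPOSED YET. The height split above; the linear-exponent version of `perHeight_bound` and the
local finest-bad-level recursion inside the glue (layer-2 helpers of HistoryTailOfInsertionL,
attached with --supports); the reflection-equivariance of the tree's corner-anchored
`BlockAveraging.blockAvg` needed by engine E2 (unchecked; if it fails only a translation-periodised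
transfer with a loss is available).

CHEAPEST FALSIFIER. Arithmetic of the glue (done by hand, passes): with u_i = 1 + log(1/g_i) ≥ 1 +
i·log L/2 (γ ≤ 1) and p₀ ≥ 1, pFun ≥ b₀·u_i, so 72·L^(3m)·L^(3i)·M₀·e^(−ε b₀ u_i) ≤ A'·2^(−i) as
soon as ε·b₀/2 ≥ 4; the recursion over local events closes when 2C·L^(3 − ε b₀/2) ≤ 1/2. Cheapest
kill of the crux: row R16 at (L, K, ε) = (2, 8, 1/2) on the existing engines (one afternoon), and
the literature row (one reading of Bałaban–O'Carroll §1).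

NUMBERS. θ(K−j) = θBal = g·pFun b₀ p₀ g with g = √(γ L^(−(K−j))); per-height plaquette count ≤
9·(2L^(m+K−j))³; b₀ := max(b₁, 8/ε, 1), p₀ := max(p₁, 3); locality radius 64·L^j (level-0 ℓ¹ torus
distance; recursion radius closes for L ≥ 3 as in LINE 15); delivered profile q(i) = A'·2^(−i), A' =
72·L^(3m)·2M₀·e^(−ε b₀)·γ^0.

DEFINITION REQUESTS. None: the local small-history event and the capped normalised flux are inlined
in the item statement.

Novelty: Searches (2026-08-28): lit search --hybrid "ultraviolet stability generating functional external
source lattice gauge theory Balaban renormalization group" (8 docs: Rivasseau 1991 pp.257–289,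
Montvay–Münster, Dimock arXiv:2009.01156 pp.76–77 — no finite-ε insertion bound); lit vsearch "class
of effective actions in Balaban's renormalization group preserved under adding small local gauge
invariant analytic perturbations; partition function with a source term uniform in the lattice
spacing" (Salmhofer, Rivasseau, Montvay–Münster — generic); lit search "Dimock renormalization group
according to Balaban III convergence correlation" → [corpus:paper:arxiv-1304.0705 p.33] Remark
(correlation functions adaptable, citing Bałaban–O'Carroll); lit search "Balaban O'Carroll
correlation functions N-vector renormalization group observable" → doi:10.1006/aphy.1997.5690,
doi:10.1007/s002200050510 [graph:crossref]; lit galaxy search "correlation functions via the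
effective actions|generating functional for lattice gauge" --star all (0 hits), "exponential moments
of Wilson loops|large field tails" --star all (0 hits), "chessboard estimate|large-field" --star pdf
(noise only); in-tree: rg over Theses/*.lean for `Real.exp (ε` / exponential-moment cruxes on 19936
(none; 28309 is a sub-Gaussian cap, 25567 a Gaussian tail at threshold).
Nearest prior art found: [corpus:paper:arxiv-2009.01156 p.7 Thm 1] (Dimock, QED₃ UV stability:
polymer activities bounded by e_k^(1/4−7ϵ)·e^(−κ d_M(X)) — the printed  [refs: 10.1006/aphy.1997.5690, 10.1007/s002200050510, 2009.01156, paper:arxiv-1304.0705, doi:10.1006/aphy.1997.5690, doi:10.1007/s002200050510, paper:arxiv-2009.01156]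

Barriers (technique_class: exponential-moment, free-energy-insertion, RG-observable): - technique_class: exponential-moment, free-energy-insertion, RG-observable
- Literature.Barriers.QuantumFields.UVStabilityNonUniqueness: inside the UV-stability class by
design (LocalInsertionL is a spacing-uniform bound on a generating functional); what stability
yields downstream is discharged by the parent's binders MinimiserStabilityRegPr /
FluctuationComparisonRegPrIntL inside UnitScaleTilt.closes, not by this line.
- Literature.Barriers.QuantumFields.ElitzurTheorem: outside — the insertion φ_a and the event G(a,j)
are gauge invariant; no gauge-variant expectation occurs.
- Literature.Barriers.QuantumFields.PerturbativeInvisibility: outside — an ultraviolet statement at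
heights below the unit scale; nothing about the mass gap or asymptotic scaling.
- Literature.Barriers.QuantumFields.StochasticQuantisationCriticality: outside — no dynamics; an
equilibrium exponential moment (d = 3).
- Literature.Barriers.QuantumFields.FixedCouplingUltralocality: outside — β_K = L^K/γ → ∞ along the
parent's tuned sequence.
- Literature.Barriers.QuantumFields.NonabelianCoulombPhaseD5: does not apply — a d = 5
phase-structure barrier (token overlap "chessboard/energy" only); this line is d = 3, ultraviolet,
and uses no infrared-bound/Coulomb-phase input.
- Literature.Barriers.QuantumFields.WilsonDeterminantSign: does not apply — concerns fermion
determinants; pure SU(2) gauge theory here (token overlap "moment/chessboard" only).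
- Literature.Barriers.QuantumFields.CenterSymmetryBreakingByQ

sub-problem: YangMills · status: open · opened planner-ym-r3-idea-2-g7-0 2026-08-28T22:01:11Z · rev 0 · ledger route-QuantumFields-LocalInsertion
GENERATED by the gate from the ledger (D-0016/17). Provers cite these decls: `theorem foo : Summit.QuantumFields.YangMills.Theses.LocalInsertion.<Decl> := …` in Summits/QuantumFields/YangMills/Theorems/<Name>.lean.
-/

namespace Summit.QuantumFields.YangMills.Theses.LocalInsertion

open scoped BigOperators Topology Manifold Classical MeasureTheory ProbabilityTheory Matrix InnerProductSpace ComplexConjugate ContinuousMap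
open Filter Set Function TopologicalSpace MeasureTheory

attribute [summit_statement] _root_.YangMills
attribute [summit_statement] _root_.Literature.MathematicalPhysics.QuantumFieldTheory.Balaban1983to89.T3YM3TorusStatement.YM3TorusSU2

/-- item stmt-QuantumFields-23607 · crux · rank 2 · open · by planner
why it might fail: the insertion has modulus up to e^(ε·p) at the edge of the small-field domain; Bałaban–O'Carroll's observable calculus is perturbative in ε (derivatives at 0), so a finite-ε bound uniform in K may need Gaussian-class control after all, or ε forced ∝ g^κ (useless).
sources: Balaban1985UV3, doi:10.1006/aphy.1997.5690, arXiv:1304.0705, arXiv:2009.01156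
[crux] For every L there is ε > 0 such that for all b₀ > 0, p₀ > 2 there are M₀ ≥ 0 and γ₁ ∈ (0,1]
with: for every family F with F.L = L, every γ ∈ (0, γ₁], every K, every height 1 ≤ j ≤ K and every
plaquette a of height j, the gibbsK-integral over the local small-history event G(a,j) of
exp(ε·min(dist1(Ū^j(∂a))/g_(K−j), pFun b₀ p₀ g_(K−j))) is at most M₀. [difficulty: XL] -/
@[route_item "route-QuantumFields-LocalInsertion", crux]
def LocalInsertionL : Prop :=
  open Literature.MathematicalPhysics.QuantumFieldTheory.Balaban1983to89 Literature.MathematicalPhysics.QuantumFieldTheory.Balaban1983to89.T3ContinuumYM3Torus in ∀ (L : ℕ), ∃ ε : ℝ, 0 < ε ∧ ∀ (b₀ p₀ : ℝ), 0 < b₀ → 2 < p₀ → ∃ M₀ : ℝ, 0 ≤ M₀ ∧ ∃ γ₁ : ℝ, 0 < γ₁ ∧ γ₁ ≤ 1 ∧ ∀ (F : T3Family) (γ : ℝ), F.L = L → 0 < γ → γ ≤ γ₁ → ∀ (K j : ℕ), 1 ≤ j → j ≤ K → ∀ (a : Plaq (F.P K) j), ∫ U in {U | (∀ (i : ℕ)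 (q : Plaq (F.P K) i), i < j → Site.tdist (fun k => ((((q.src k).val * F.L ^ i : ℕ)) : ZMod ((F.P K).sitesPerDir 0))) (fun k => ((((a.src k).val * F.L ^ j : ℕ)) : ZMod ((F.P K).sitesPerDir 0))) + 64 * F.L ^ i ≤ 64 * F.L ^ j → GaugeGroup.dist1 (GaugeField.plaqHol (Averaging.iter (fun i' => BlockAveraging.blockAvg (P := F.P K) (j := i') T3UnitLawDensityEML.ℰp) i U) q) < T3UnitScaleTilt.θBal F.L γ b₀ p₀ (K - i))}, Real.exp (ε * min (GaugeGroup.dist1 (GaugeField.plaqHol (Averaging.iter (fun i' => BlockAveraging.blockAvg (P := F.P K) (j := i') T3UnitLawDensityEML.ℰp) j U) a) / Real.sqrt (γ * ((F.L : ℝ)⁻¹) ^ (K - j))) (B10.pFun b₀ p₀ (Real.sqrt (γ * ((F.L : ℝ)⁻¹) ^ (K - j))))) ∂(T3UnitScaleTilt.gibbsK F T3UnitLawDensityEML.ℰp γ K) ≤ M₀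

/-- item stmt-QuantumFields-20520 · crux · rank 3 · open · by operator
why it might fail: interior excision of the fluctuation integral at printed regularity may lose the ε₀-uniformity in m (parent route's recorded risk).
sources: Balaban1985UV3, Balaban1988Convergent
[crux] K1b-INT (E-INT interior excision of FluctuationComparisonRegPrL, OWNER RULING g22-№3 §B +
ADDENDUM 1; card C8 `edge-band-to-the-tail`): for every L there are an EXCISION RATIO 0 < c ≤ 1 and
THRESHOLDS (b₁, p₁) such that for every profile (b₀, p₀) with b₁ ≤ b₀, p₁ ≤ p₀, 0 < b₀, 2 < p₀ there
is ε₁ > 0 such that for every 0 < ε₀ ≤ ε₁ there is m₀ such that for every m ≥ m₀ there is a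
volume-uniform γ₁ > 0 such that for every T3Family F with F.L = L and 0 < γ ≤ γ₁,
`T3InteriorExcision.FluctuationComparisonRegPrIntAt F γ b₀ p₀ m c ε₀`: a.e. on the SHRUNK window
`PlaqSmall (θBal L γ (c·b₀) p₀ (K/m))` both restricted height densities of runs K and K+1 on the
histGood events at the ORIGINAL profile (b₀, p₀) are positive and log ρ + β·minActionRegPr of the
two runs agree modulo constants κ_K up to summable r_K (same body as FluctuationComparisonRegPrAt;
only the a.e. guard is the c-window). FORMALLY WEAKER than FluctuationComparisonRegPrL (c = 1;
window monotone in b₀: `θBal_mono_b`), NO edge clause (the band {θ(c·b₀)-large, θ(b₀)-small} is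
charged to HistoryTailL, whose profile floor absorbs the rescaling:
`T3InteriorExcision.unitTiltTail_of_interior`), and on the c-window print's χ -/
@[route_item "route-QuantumFields-LocalInsertion", crux]
def FluctuationComparisonRegPrIntL : Prop :=
  open Literature.MathematicalPhysics.QuantumFieldTheory.Balaban1983to89 Literature.MathematicalPhysics.QuantumFieldTheory.Balaban1983to89.T3ContinuumYM3Torus in ∀ (L : ℕ), ∃ (c b₁ p₁ : ℝ), 0 < c ∧ c ≤ 1 ∧ ∀ (b₀ p₀ : ℝ), b₁ ≤ b₀ → p₁ ≤ p₀ → 0 < b₀ → 2 < p₀ → ∃ ε₁ : ℝ, 0 < ε₁ ∧ ∀ (ε₀ : ℝ), 0 < ε₀ → ε₀ ≤ ε₁ → ∃ m₀ : ℕ, ∀ (m : ℕ), m₀ ≤ m → ∃ γ₁ : ℝ, 0 < γ₁ ∧ ∀ (F : T3Family) (γ : ℝ), F.L = L → 0 < γ → γ ≤ γ₁ → T3InteriorExcision.FluctuationComparisonRegPrIntAt F γ b₀ p₀ m c ε₀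

/-- item stmt-QuantumFields-19200 · crux · rank 4 · open · by operator
why it might fail: stability of the printed regular minimiser needs the B13 contraction constants uniformly in the torus size (parent route's recorded risk).
sources: Balaban1985UV3, Balaban1987RG1
[crux] K1aR-pr (E-min at the minimum over PRINT'S regular space (6) of Balaban1985Variational IN
FULL — both clauses of (2): small plaquette variables AND small covariant divergence
Balaban1985RegularSpaces (1.9); replaces MinimiserStability stmt-QuantumFields-19822; supersedes
children-v2's plaquette-only MinimiserStabilityReg, which needed the unprinted gap G-K1aR-1 on top
of [7] Thm 1) — for every block size L there is ε₁(L) > 0 (the uniqueness radius a₀ of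
Balaban1985Variational Thm 1, «depends on d and L only») such that for every 0 < ε₀ ≤ ε₁, all
sufficiently large m ≥ m₀(L, ε₀), every profile (b₀, p₀) and all 0 < γ ≤ γ₁(L, ε₀, m, b₀, p₀), every
T3Family F with F.L = L: `MinimiserStabilityRegPrAt F γ b₀ p₀ m ε₀` (tree module
`T3PrintedRegularMinimiser` = `BgStabilityAt` at the printed backgrounds `bgRegPr`/`bgRegPr'`) —
summable r_K ≥ 0 and constants κ_K with, for every K and EVERY θBal(⌊K/m⌋)-small field V on the
comparison lattice, |β_{K+1}·minActionRegPr_{K+1}(V) − β_K·minActionRegPr_K(V) − κ_K| ≤ r_K (κ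
idle), where minActionRegPr_K(V) = inf of the Wilson action over run K's fibre of V ∩ {|U(∂p) − 1| <
ε₀L^{-2(K−⌊K/m⌋)} ∀p} ∩ {‖(D^{1*}_U ∂U)(b)‖ < ε₀L^{-3(K−⌊K/m⌋)} ∀b} (d -/
@[route_item "route-QuantumFields-LocalInsertion", crux]
def MinimiserStabilityRegPr : Prop :=
  open Literature.MathematicalPhysics.QuantumFieldTheory.Balaban1983to89 Literature.MathematicalPhysics.QuantumFieldTheory.Balaban1983to89.T3ContinuumYM3Torus in ∀ (L : ℕ), ∃ ε₁ : ℝ, 0 < ε₁ ∧ ∀ (ε₀ : ℝ), 0 < ε₀ → ε₀ ≤ ε₁ → ∃ m₀ : ℕ, ∀ (m : ℕ), m₀ ≤ m → ∀ (b₀ p₀ : ℝ), 0 < b₀ → 2 < p₀ → ∃ γ₁ : ℝ, 0 < γ₁ ∧ ∀ (F : T3Family) (γ : ℝ), F.L = L → 0 < γ → γ ≤ γ₁ → T3PrintedRegularMinimiser.MinimiserStabilityRegPrAt F γ b₀ p₀ m ε₀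

/-- item stmt-QuantumFields-23608 · support · rank 9 · closed · proved by Summit.QuantumFields.YangMills.Theorems.LocalInsertion.HistoryTailOfInsertion.historyTailOfInsertionL_proof (prover) · by planner
sources: Balaban1985UV3
[support] The glue: LocalInsertionL implies UnitScaleTilt.HistoryTailL — Chernoff at the fixed ε (on
the event the capped variable equals its cap), the finest-bad-level recursion T_j ≤
M₀e^(−εp(g_(K−j))) + C·Σ_(i<j) L^(3(j−i))·T_i over the local events (closing because p(g_(K−i)) −
p(g_(K−j)) ≥ b₀(j−i)·log L/2 and b₀ ≥ 8/ε), the bare level from `T3BareTailProfile.bareTailAt`, then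
the union bound and packaging of `averagedTailAt_of_perPlaquette`/`historyTailAt_of_averagedTailAt`
with the linear exponent; choose b₀ := max(b₁, 8/ε, 1), p₀ := max(p₁, 3). [deps: LocalInsertionL]
[difficulty: L] -/
@[route_item "route-QuantumFields-LocalInsertion", crux]
def HistoryTailOfInsertionL : Prop :=
  LocalInsertionL → Summit.QuantumFields.YangMills.Theses.UnitScaleTilt.HistoryTailL

-- `HistoryTailOfInsertionL` holds: proved by `Summit.QuantumFields.YangMills.Theorems.LocalInsertion.HistoryTailOfInsertion.historyTailOfInsertionL_proof` (its module imports this route file, so no `_holds` link can be stated here).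

/-- item stmt-QuantumFields-23609 · assembly · rank 1 · closed · proved by Summit.QuantumFields.YangMills.Theorems.localInsertion_assembly_proof (prover) · by planner
sources: Balaban1985UV3
[assembly] MinimiserStabilityRegPr → FluctuationComparisonRegPrIntL → LocalInsertionL →
HistoryTailOfInsertionL → the leaf YM3TorusSU2. -/
@[route_item "route-QuantumFields-LocalInsertion"]
def Assembly : Prop :=
  MinimiserStabilityRegPr → FluctuationComparisonRegPrIntL → LocalInsertionL → HistoryTailOfInsertionL → Literature.MathematicalPhysics.QuantumFieldTheory.Balaban1983to89.T3YM3TorusStatement.YM3TorusSU2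

-- `Assembly` holds: proved by `Summit.QuantumFields.YangMills.Theorems.localInsertion_assembly_proof` (its module imports this route file, so no `_holds` link can be stated here).

/-! D-0027 §2.1 — DECIDING THEOREM (planner-authored via `route open/edit --closes-file`; by planner-ym-r3-idea-2-g7-0 2026-08-28T22:01:11Z):
its hypotheses are this route's items and its conclusion the registered leaf `Literature.MathematicalPhysics.QuantumFieldTheory.Balaban1983to89.T3YM3TorusStatement.YM3TorusSU2` (rung R3, D-0061) (glue_lint), and it elaborates with this file. -/

@[closes "route-QuantumFields-LocalInsertion"] theorem closes (h200 : MinimiserStabilityRegPr) (h201 : FluctuationComparisonRegPrIntL)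
    (hI : LocalInsertionL) (hG : HistoryTailOfInsertionL) :
    Literature.MathematicalPhysics.QuantumFieldTheory.Balaban1983to89.T3YM3TorusStatement.YM3TorusSU2 :=
  Summit.QuantumFields.YangMills.Theses.UnitScaleTilt.closes h200 h201 (hG hI)

end Summit.QuantumFields.YangMills.Theses.LocalInsertion
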